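import Summits.QuantumFields.BalabanUV.T4Continuum.Support.SubstrateTransporterSpeciesAnalytic
import Summits.QuantumFields.BalabanUV.T4Continuum.Support.CovariantVectorCoerciveHolo
import Summits.QuantumFields.BalabanUV.T4Continuum.Support.CovariantVectorGreenOfField

/-!
# SUBSTRATE — [dict] D-8 AT LEVEL LETTERS (S-LEV, typer RULING (η1) «Q-F1 = (i) LEVEL-LETTER UPSTREAM»): the level-lettered regular set
# `regularSetLev`, the level-lettered covariance species `covAtTLev`, and — at the PRINTED letters `c_k = L^k`, `a_k = a′·L^{kd}` — ONE EXPLICIT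
# chart ball `ball 0 ρ⋆`, `ρ⋆ = min_k holoRadius_k`, on which every entry of the species is analytic AT EVERY LEVEL and `‖greenT_k‖ ≤ 2/γ_k`

Cell `pub-balaban`, SUBSTRATE cell, seat `b2b-balaban-substrate-p1` (gen 3); typer-liaison gen 7 ruling (η1) items 1–2, statements = typer sketch
v0.7 §LEV.  CREDIT: sections §1–§3 and the `Family` half (module `SubstrateComplexBackgroundLev`) are the FINDER lineage's kernel probe — ne9-leaf-04
g14 (F-ne9leaf04g14-1) ∕ g15 (A1) ∕ g16 (ADDENDUM A2, `ProbeF1A2QuantBallAtHead.rc0.lean`) — adopted with the names of record; §4 (the tower OF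
RECORD) types for real what the sketch left as a remark.  Summits-side under the LEAN PLACEMENT RULE.

HONEST FRAMING: rung (B)+1 of the FINITE-VOLUME T⁴ programme — NOT infinite volume, NOT a mass gap, NOT Clay; spine PROVED 0∕9; NE4 ∕ NE9 NOT
proved.  BOOKKEEPING ∕ COMPOSITION BY NAME, 0 analysis: no radius is computed beyond the `min` of p3's per-level `holoRadius` (itself a choice by
continuity, `CovariantVectorCoerciveHolo` §(c)); nothing printed is asserted ([Balaban1985BackgroundPropagators] Sect. B ∕ Thm 3.4, [Balaban1987RG1]
(1.18) KIND only).  HONEST DEPENDENCY (cell line, verbatim): continuum YM on T⁴ ⇐ BetaPertH ∧ nine spine estimates (0/9 proved); BetaPertH ⇐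
(D1) ∧ (D4) ∧ CAP+tail; G-an2-4 gates asym, D1 and NE2/3/4.

WHY (the fork located by F-ne9leaf04g14-1, nothing landed is false).  `covAtT P c a s Γ` ∕ `regularSet P c a Γ R⁰` (p220490 ∕ p221143 ∕ p221513 ∕
p222080) carry ONE pair `(c, a)` for all levels, while the quantitative J-road (J-1 `coercive_vecOp`, J-3a `isUnit_det_deltaQOf_of_regular`, VECJ-H
`holoRadius`, `‖greenT‖ ≤ 2/γ`) inhabits level `k` only at the printed letters `(c, a) = (L^k, a′·L^{kd})` — so the single-pair all-level binders
are served one level at a time for `K ≥ 1`.  RULE OF RECORD (η1): species modules are BORN level-lettered (`cL : ℕ → ℂ`, `aL : ℕ → ℝ`); the single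
pair is the constant-letter case (`covAtTLev_const`, `rfl`) — COEXISTENCE: no declaration of p220490 ∕ p221143 ∕ p221513 ∕ p221997 ∕ p220637 is
touched or re-filed.

WHAT.
* §1 `regularSetLev P cL aL Γ R⁰ := ⋂ k, regularSetAt P (cL k) (aL k) Γ R⁰ k`, `isOpen_regularSetLev`; the printed letters `cPr P k := ↑(lev P.L k)`,
  `aPr P a′ k := a′·(lev P.L k)^d`; **`rhoStar`** `:= Finset.univ.inf' (k ↦ holoRadius_k)` for a unitary, levelwise `γ_k`-coercive reference tower
  (`rhoStar_pos`, `rhoStar_le`), **`ball_rhoStar_subset_regularSetLev`**, **`opNorm_greenT_le_on_ball`** (`‖greenT_k‖ ≤ 2/γ_k` at EVERY level on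
  ONE ball — the Cauchy input), `zero_mem_regularSetLev_printed`.
* §2 `covAtTLev P cL aL Γ s R S k := covAtT P (cL k) (aL k) s Γ R S k`, `covAtTLev_const` (`rfl`), **`analyticOnNhd_covAtTLev_expChart`** on
  `regularSetLev` (p221513 `analyticOnNhd_unitCovT_expChartT` BY NAME at `(cL k, aL k)`).
* §3 at the printed letters: **`analyticOnNhd_covAtTLev_printed_on_ball`** (every entry analytic on `ball 0 ρ⋆`, every level),
  **`exists_ball_analyticOnNhd_covAtTLev_printed`** (p221513's `∃ ρ > 0` WITNESSED by `ρ⋆`).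
* §4 the tower OF RECORD `R⁰ := towerDataOf P ι av U` (unitary `ι`): **`coercive_vecOp_towerDataOf_of_regular`**
  (regularity letters `α`, `τ` displayed per level ⇒ `γ_k`-coercive at EVERY level with the LEVEL-FREE `γ_k := gammaV (card o) d a′ α τ`, J-3a
  `coercive_deltaQOf_of_regular` + `deltaQOf_eq_vecOp` BY NAME), hence **`rhoStarOfRecord`** (+ `_pos`), `ball_rhoStarOfRecord_subset_regularSetLev`,
  `opNorm_greenT_le_on_ball_towerDataOf`, **`analyticOnNhd_covAtTLev_printed_towerDataOf`** ∕ `exists_ball_analyticOnNhd_covAtTLev_printed_towerDataOf`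
  (the quantitative analytic ball AT THE RECORD: no `hco`∕`hR⁰` binder left, only the small-field letters and `0 < gammaV`), and the record identity
  `covAtOfRecord_eq_covAtTLev` (instance of p220490 `covAtOfRecord_eq_covAtT`) with its chart-centre form `covAtOfRecord_eq_covAtTLev_expChartT_zero`.
Consumers: NE9 END (`rawTKernel` letters — t4-ne9-p1), NE4 L3 (`ρ⋆` = the one `α` for all `(k, p)` — module `SubstrateProbesChartLev`), NE5 O1 on
request.  The D-8 (v) family half is `SubstrateComplexBackgroundLev`.
-/

noncomputable section

open scoped BigOperators ComplexConjugate Matrix Matrix.Norms.L2Operator Kronecker ComplexOrder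

namespace Summit.QuantumFields.BalabanUV.T4Continuum.SubstrateTransporterSpeciesLev

open Literature.MathematicalPhysics.QuantumFieldTheory.Balaban1983to89
open Literature.MathematicalPhysics.QuantumFieldTheory.Balaban1983to89.B5Prop11Plancherel (Tor fine)
open Literature.MathematicalPhysics.QuantumFieldTheory.Balaban1983to89.B5G183RateUnitTower (lev lev_neZero)
open Summit.QuantumFields.BalabanUV.T4Continuum
open Summit.QuantumFields.BalabanUV.T4Continuum.CoerciveInverseTower (Coercive)
open Summit.QuantumFields.BalabanUV.T4Continuum.CovariantVectorCoercive (vecOp gammaV)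
open Summit.QuantumFields.BalabanUV.T4Continuum.CovariantVectorCoerciveHolo
open Summit.QuantumFields.BalabanUV.T4Continuum.CovariantVectorGreenOfField (coercive_deltaQOf_of_regular deltaQOf_eq_vecOp)
open Summit.QuantumFields.BalabanUV.T4Continuum.SubstrateBackgroundTransporters (transV siteIdx unitMod transV_mem_unitaryGroup)
open Summit.QuantumFields.BalabanUV.T4Continuum.SubstrateTransporterSpecies
open Summit.QuantumFields.BalabanUV.T4Continuum.SubstrateTransporterSpeciesHolo
open Summit.QuantumFields.BalabanUV.T4Continuum.SubstrateTransporterSpeciesAnalytic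
open Summit.QuantumFields.BalabanUV.T4Continuum.CovariantBlockAveraging (ContourSystem transport)

variable (P : Params) {o : Type*} [Fintype o] [DecidableEq o]
variable (cL : ℕ → ℂ) (aL : ℕ → ℝ) (Γ : (k : ℕ) → ContourSystem P.d (lev P.L k) (unitMod P))

/-! ## §1 The level-lettered regular set and its EXPLICIT ball at the printed letters -/

/-- [folklore] **THE LEVEL-LETTERED REGULAR SET** of the chart at `R⁰`: the landed level-`k` regular sets `regularSetAt` (p221143), read at the
level-`k` letters `(cL k, aL k)` and intersected over `k ≤ K`. -/
def regularSetLev (R₀ : TowerData P o) : Set (TowerData P o) := ⋂ k : Fin (P.K + 1), regularSetAt P (cL k) (aL k) Γ R₀ k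

/-- [folklore] Membership in the level-lettered regular set, unfolded. -/
theorem mem_regularSetLev_iff (R₀ A : TowerData P o) :
    A ∈ regularSetLev P cL aL Γ R₀ ↔ ∀ k : Fin (P.K + 1), A ∈ regularSetAt P (cL k) (aL k) Γ R₀ k := Set.mem_iInter

/-- [folklore] The level-lettered regular set is OPEN (finite intersection of p221143's open level sets `isOpen_regularSetAt`). -/
theorem isOpen_regularSetLev (R₀ : TowerData P o) : IsOpen (regularSetLev P cL aL Γ R₀) :=
  isOpen_iInter_of_finite fun k => isOpen_regularSetAt P (cL k) (aL k) Γ R₀ k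

/-- [folklore] At CONSTANT letters the level-lettered regular set IS the landed single-pair `regularSet` (coexistence, `rfl`). -/
theorem regularSetLev_const (c : ℂ) (a : ℝ) (R₀ : TowerData P o) : regularSetLev P (fun _ => c) (fun _ => a) Γ R₀ = regularSet P c a Γ R₀ := rfl

/-- [folklore] The PRINTED lattice letter of level `k`: `η_k⁻¹ = L^k` ([Balaban1984PropagatorsI] (1.18) KIND; `lev P.L k`). -/
abbrev cPr (k : ℕ) : ℂ := ((lev P.L k : ℕ) : ℂ)

/-- [folklore] The PRINTED mass letter of level `k`: `a′·L^{kd}` (`Q* = n^d Qᴴ`, [Balaban1984PropagatorsI] (1.69) KIND). -/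
abbrev aPr (a' : ℝ) (k : ℕ) : ℝ := a' * ((lev P.L k : ℕ) : ℝ) ^ P.d

variable {R₀ : TowerData P o} (hR₀ : ∀ (k : Fin (P.K + 1)) ν i, R₀ k ν i ∈ Matrix.unitaryGroup o ℂ) {a' : ℝ} {γ : Fin (P.K + 1) → ℝ}
  (hco : ∀ k : Fin (P.K + 1), Coercive (γ k) (vecOp (lev P.L k) (unitMod P) a' (Γ k) (R₀ k))) (hγ : ∀ k, 0 < γ k)

/-- [folklore] **`ρ⋆`** — the EXPLICIT radius of a unitary, levelwise `γ_k`-coercive reference tower: the least of the finitely many per-level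
`holoRadius` of p3 (`CovariantVectorCoerciveHolo` §(c); no choice beyond p3's own, no openness argument). -/
def rhoStar : ℝ := Finset.univ.inf' Finset.univ_nonempty fun k : Fin (P.K + 1) => holoRadius (lev P.L k) (unitMod P) (hR₀ k) (hco k) (hγ k)

/-- [folklore] `0 < ρ⋆` (p3's `holoRadius_pos` at every level). -/
theorem rhoStar_pos : 0 < rhoStar P Γ hR₀ hco hγ := by
  simp only [rhoStar, Finset.lt_inf'_iff]
  exact fun k _ => holoRadius_pos _ _ _ _ _

/-- [folklore] `ρ⋆ ≤ holoRadius_k` at every level. -/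
theorem rhoStar_le (k : Fin (P.K + 1)) : rhoStar P Γ hR₀ hco hγ ≤ holoRadius (lev P.L k) (unitMod P) (hR₀ k) (hco k) (hγ k) :=
  Finset.inf'_le _ (Finset.mem_univ k)

/-- [folklore] **THE EXPLICIT BALL LIES IN THE LEVEL-LETTERED REGULAR SET AT THE PRINTED LETTERS** — p3's `ball_subset_regularSetAt` BY NAME at
every level (the statement no single pair `(c, a)` can receive for `K ≥ 1`). -/
theorem ball_rhoStar_subset_regularSetLev :
    Metric.ball (0 : TowerData P o) (rhoStar P Γ hR₀ hco hγ) ⊆ regularSetLev P (cPr P) (aPr P a') Γ R₀ := fun _ hA =>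
  Set.mem_iInter.2 fun k => ball_subset_regularSetAt P Γ k (hR₀ k) (hco k) (hγ k) (Metric.ball_subset_ball (rhoStar_le P Γ hR₀ hco hγ k) hA)

/-- [folklore] … and on that ball the level-`k` Green's function is bounded by `2/γ_k` AT EVERY LEVEL (p3's `opNorm_greenT_le_of_mem_ball`) — the
Cauchy input of NE9's END, on ONE ball for all levels. -/
theorem opNorm_greenT_le_on_ball {A : TowerData P o} (hA : A ∈ Metric.ball (0 : TowerData P o) (rhoStar P Γ hR₀ hco hγ)) (k : Fin (P.K + 1)) :
    ‖greenT (lev P.L k) (unitMod P) (cPr P k) (aPr P a' k) (Γ k) (expChartT P R₀ A k) (expChartInvT P R₀ A k)‖ ≤ 2 / γ k :=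
  opNorm_greenT_le_of_mem_ball P Γ k (hR₀ k) (hco k) (hγ k) (lt_of_lt_of_le (mem_ball_zero_iff.1 hA) (rhoStar_le P Γ hR₀ hco hγ k))

include hR₀ hco hγ in
/-- [folklore] The centre of the chart is regular AT EVERY LEVEL at the printed letters (`0 ∈ ball 0 ρ⋆ ⊆ regularSetLev`). -/
theorem zero_mem_regularSetLev_printed : (0 : TowerData P o) ∈ regularSetLev P (cPr P) (aPr P a') Γ R₀ :=
  ball_rhoStar_subset_regularSetLev P Γ hR₀ hco hγ (Metric.mem_ball_self (rhoStar_pos P Γ hR₀ hco hγ))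

/-! ## §2 The level-lettered species and its analyticity on `regularSetLev` -/

variable (s : ℕ → ℂ)

/-- [folklore] **THE LEVEL-LETTERED COVARIANCE FAMILY**: the landed `covAtT` (p220490), read at letters `(cL k, aL k)` at level `k` (one line —
`covAtT … k` only reads level `k`; levels `k > K` read `0`). -/
def covAtTLev (R S : TowerData P o) (k : ℕ) {T : Type*} (t : T) (b b' : (Tor (unitMod P) × Fin P.d) × o) : ℂ :=
  covAtT P (cL k) (aL k) s Γ R S k t b b'

/-- [folklore] Unfolding `covAtTLev` at level `k`. -/
theorem covAtTLev_apply (R S : TowerData P o) (k : ℕ) {T : Type*} (t : T) (b b' : (Tor (unitMod P) × Fin P.d) × o) :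
    covAtTLev P cL aL Γ s R S k t b b' = covAtT P (cL k) (aL k) s Γ R S k t b b' := rfl

/-- [folklore] COEXISTENCE: at a single pair the level-lettered family IS the landed one (`rfl`). -/
theorem covAtTLev_const (c : ℂ) (a : ℝ) (R S : TowerData P o) (k : ℕ) {T : Type*} (t : T) (b b' : (Tor (unitMod P) × Fin P.d) × o) :
    covAtTLev P (fun _ => c) (fun _ => a) Γ s R S k t b b' = covAtT P c a s Γ R S k t b b' := rfl

/-- [folklore] **EVERY ENTRY OF `covAtTLev` ALONG THE TOWER CHART IS ANALYTIC ON `regularSetLev`** — p221513's `analyticOnNhd_unitCovT_expChartT`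
BY NAME at `(cL k, aL k)` (the level-`k` conjunct of `regularSetLev` is exactly its hypothesis set). -/
theorem analyticOnNhd_covAtTLev_expChart (R₀ : TowerData P o) (k : ℕ) {T : Type*} (t : T) (b b' : (Tor (unitMod P) × Fin P.d) × o) :
    AnalyticOnNhd ℂ (fun A : TowerData P o => covAtTLev P cL aL Γ s (expChartT P R₀ A) (expChartInvT P R₀ A) k t b b')
      (regularSetLev P cL aL Γ R₀) := by
  unfold covAtTLev covAtT
  by_cases hk : k ≤ P.K
  · simp only [dif_pos hk]
    intro A₀ hA₀
    exact analyticAt_matrix_iff.1 (analyticOnNhd_unitCovT_expChartT P (cL k) (aL k) Γ R₀ ⟨k, Nat.lt_succ_of_le hk⟩ (s k) A₀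
      (Set.mem_iInter.1 hA₀ _)) b b'
  · simp only [dif_neg hk]
    exact fun _ _ => analyticAt_const

/-- [folklore] … hence ℂ-differentiable there (the notion NE9's `analyticClass` is phrased in). -/
theorem differentiableOn_covAtTLev_expChart (R₀ : TowerData P o) (k : ℕ) {T : Type*} (t : T) (b b' : (Tor (unitMod P) × Fin P.d) × o) :
    DifferentiableOn ℂ (fun A : TowerData P o => covAtTLev P cL aL Γ s (expChartT P R₀ A) (expChartInvT P R₀ A) k t b b')
      (regularSetLev P cL aL Γ R₀) :=
  (analyticOnNhd_covAtTLev_expChart P cL aL Γ s R₀ k t b b').differentiableOn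

/-- [folklore] The OPENNESS ball form at general letters (as p221513's `exists_ball_analyticOnNhd_covAtT`; `ρ` NOT computed): a centre regular at
every level at the letters `(cL k, aL k)` carries a chart ball on which every entry of `covAtTLev` is analytic. -/
theorem exists_ball_analyticOnNhd_covAtTLev {R₀ : TowerData P o} (h0 : (0 : TowerData P o) ∈ regularSetLev P cL aL Γ R₀) :
    ∃ ρ > 0, ∀ (k : ℕ) {T : Type*} (t : T) (b b' : (Tor (unitMod P) × Fin P.d) × o),
      AnalyticOnNhd ℂ (fun A : TowerData P o => covAtTLev P cL aL Γ s (expChartT P R₀ A) (expChartInvT P R₀ A) k t b b')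
        (Metric.ball (0 : TowerData P o) ρ) := by
  obtain ⟨ρ, hρ, hsub⟩ := Metric.isOpen_iff.1 (isOpen_regularSetLev P cL aL Γ R₀) 0 h0
  exact ⟨ρ, hρ, fun k _ t b b' => (analyticOnNhd_covAtTLev_expChart P cL aL Γ s R₀ k t b b').mono hsub⟩

/-! ## §3 THE QUANTITATIVE ANALYTIC BALL at the printed letters -/

/-- [folklore] **AT THE PRINTED LETTERS EVERY ENTRY OF THE LEVEL-LETTERED COVARIANCE FAMILY ALONG THE CHART IS ANALYTIC ON THE EXPLICIT BALL
`ball 0 ρ⋆`** (unitary, levelwise `γ_k`-coercive reference tower; radius BY NAME from p3, analyticity BY NAME from p1 — the all-level statement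
neither single-pair file can give the other for `K ≥ 1`). -/
theorem analyticOnNhd_covAtTLev_printed_on_ball (k : ℕ) {T : Type*} (t : T) (b b' : (Tor (unitMod P) × Fin P.d) × o) :
    AnalyticOnNhd ℂ (fun A : TowerData P o => covAtTLev P (cPr P) (aPr P a') Γ s (expChartT P R₀ A) (expChartInvT P R₀ A) k t b b')
      (Metric.ball (0 : TowerData P o) (rhoStar P Γ hR₀ hco hγ)) :=
  (analyticOnNhd_covAtTLev_expChart P (cPr P) (aPr P a') Γ s R₀ k t b b').mono (ball_rhoStar_subset_regularSetLev P Γ hR₀ hco hγ)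

include hR₀ hco hγ in
/-- [folklore] The `∃ ρ > 0` shape of p221513's `exists_ball_analyticOnNhd_covAtT`, now WITNESSED by `ρ⋆` (`.differentiableOn` gives NE9's
`analyticClass` shape). -/
theorem exists_ball_analyticOnNhd_covAtTLev_printed :
    ∃ ρ > 0, ∀ (k : ℕ) {T : Type*} (t : T) (b b' : (Tor (unitMod P) × Fin P.d) × o),
      AnalyticOnNhd ℂ (fun A : TowerData P o => covAtTLev P (cPr P) (aPr P a') Γ s (expChartT P R₀ A) (expChartInvT P R₀ A) k t b b')
        (Metric.ball (0 : TowerData P o) ρ) :=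
  ⟨rhoStar P Γ hR₀ hco hγ, rhoStar_pos P Γ hR₀ hco hγ, fun k _ t b b' => analyticOnNhd_covAtTLev_printed_on_ball P Γ hR₀ hco hγ s k t b b'⟩

/-! ## §4 The tower OF RECORD: the coercivity letters from J-3a BY NAME, the explicit ball at the record -/

section Record

variable {G : Type*} [GaugeGroup G] (ι : G →* Matrix o o ℂ) (av : ∀ j, Averaging P j G)

/-- [folklore] D-8 (i) AT LEVEL LETTERS: the covariance family OF RECORD read at the level-`k` letters `(cL k, aL k)` IS the real slice of
`covAtTLev` at the tower data of record (instance of p220490's `covAtOfRecord_eq_covAtT`). -/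
theorem covAtOfRecord_eq_covAtTLev (U : GaugeField P 0 G) (k : ℕ) {T : Type*} (t : T) (b b' : (Tor (unitMod P) × Fin P.d) × o) :
    SubstrateRawSpecies.covAtOfRecord P ι av (cL k) (aL k) s Γ U k t b b' =
      covAtTLev P cL aL Γ s (towerDataOf P ι av U) (fun k => adjOf (towerDataOf P ι av U k)) k t b b' := by
  simp only [covAtTLev, covAtOfRecord_eq_covAtT]

/-- [folklore] … and, for unitary-valued `ι`, it is the chart-read family at the CENTRE `A = 0` of the chart at `R⁰ := towerDataOf P ι av U`
(instance of p221143's `covAtOfRecord_eq_covAtT_expChartT_zero`). -/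
theorem covAtOfRecord_eq_covAtTLev_expChartT_zero (hι : ∀ g, ι g ∈ Matrix.unitaryGroup o ℂ) (U : GaugeField P 0 G) (k : ℕ) {T : Type*}
    (t : T) (b b' : (Tor (unitMod P) × Fin P.d) × o) :
    SubstrateRawSpecies.covAtOfRecord P ι av (cL k) (aL k) s Γ U k t b b' =
      covAtTLev P cL aL Γ s (expChartT P (towerDataOf P ι av U) 0) (expChartInvT P (towerDataOf P ι av U) 0) k t b b' :=
  covAtOfRecord_eq_covAtT_expChartT_zero P (cL k) (aL k) Γ ι av s hι U k t b b'

variable {a' α τ : ℝ}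

/-- [folklore] **THE COERCIVITY LETTERS AT THE TOWER OF RECORD, FROM J-3a BY NAME**: if `‖ι g − 1‖ = dist1 g`, `0 < a′`, and at every level `k ≤ K`
the block-averaged background `M^{K−k} U` is regular with the DISPLAYED letters (`L^k·dist1 ≤ α` on every bond, contour transport within `τ` of `1`),
then the level-`k` vector operator at the tower data of record is `γ`-coercive with the LEVEL-FREE `γ := gammaV (card o) d a′ α τ` — p3's
`coercive_deltaQOf_of_regular` transported through `deltaQOf_eq_vecOp` (`rfl`); exactly the `hco` of `rhoStar`. -/
theorem coercive_vecOp_towerDataOf_of_regular (hdist : ∀ g : G, ‖ι g - 1‖ = dist1 g) (U : GaugeField P 0 G) (ha' : 0 < a') (hα : 0 ≤ α)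
    (hτ : 0 ≤ τ) (hU : ∀ (k : Fin (P.K + 1)) (b : PBond P (P.K - k)), ((lev P.L k : ℕ) : ℝ) * dist1 (Averaging.iter av (P.K - k) U b) ≤ α)
    (hT : ∀ (k : Fin (P.K + 1)) y jj μ (t : Fin (lev P.L k)),
      ‖transport (fine (lev P.L k) (unitMod P)) (towerDataOf P ι av U k) μ (Γ k y jj μ t) - 1‖ ≤ τ)
    (k : Fin (P.K + 1)) : Coercive (gammaV (Fintype.card o) P.d a' α τ) (vecOp (lev P.L k) (unitMod P) a' (Γ k) (towerDataOf P ι av U k)) := by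
  have h := coercive_deltaQOf_of_regular P ι (Nat.sub_add_cancel (Nat.le_of_lt_succ k.2)) (Γ := Γ k) hdist ha' hα hτ (hU k) (hT k)
  rw [deltaQOf_eq_vecOp] at h
  exact h

/-- [folklore] **`ρ⋆` AT THE RECORD**: the explicit radius `rhoStar` of the tower data of record of a levelwise-regular configuration `U`
(unitary `ι`; the `hR⁰`, `hco`, `hγ` binders of `rhoStar` discharged by `transV_mem_unitaryGroup` (the tower of record is unitary — `NE9ChartFaceOperator.towerDataOf_mem_unitaryGroup` states the same
row-side), `coercive_vecOp_towerDataOf_of_regular` and the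
ONE margin `0 < gammaV`). -/
def rhoStarOfRecord (hι : ∀ g, ι g ∈ Matrix.unitaryGroup o ℂ) (hdist : ∀ g : G, ‖ι g - 1‖ = dist1 g) (U : GaugeField P 0 G) (ha' : 0 < a')
    (hα : 0 ≤ α) (hτ : 0 ≤ τ)
    (hU : ∀ (k : Fin (P.K + 1)) (b : PBond P (P.K - k)), ((lev P.L k : ℕ) : ℝ) * dist1 (Averaging.iter av (P.K - k) U b) ≤ α)
    (hT : ∀ (k : Fin (P.K + 1)) y jj μ (t : Fin (lev P.L k)),
      ‖transport (fine (lev P.L k) (unitMod P)) (towerDataOf P ι av U k) μ (Γ k y jj μ t) - 1‖ ≤ τ)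
    (hγV : 0 < gammaV (Fintype.card o) P.d a' α τ) : ℝ :=
  rhoStar P Γ (fun k ν i => transV_mem_unitaryGroup _ hι (Averaging.iter av (P.K - k) U) ν i)
    (coercive_vecOp_towerDataOf_of_regular P Γ ι av hdist U ha' hα hτ hU hT) fun _ => hγV

variable (hι : ∀ g, ι g ∈ Matrix.unitaryGroup o ℂ) (hdist : ∀ g : G, ‖ι g - 1‖ = dist1 g) (U : GaugeField P 0 G) (ha' : 0 < a')
  (hα : 0 ≤ α) (hτ : 0 ≤ τ)
  (hU : ∀ (k : Fin (P.K + 1)) (b : PBond P (P.K - k)), ((lev P.L k : ℕ) : ℝ) * dist1 (Averaging.iter av (P.K - k) U b) ≤ α)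
  (hT : ∀ (k : Fin (P.K + 1)) y jj μ (t : Fin (lev P.L k)),
    ‖transport (fine (lev P.L k) (unitMod P)) (towerDataOf P ι av U k) μ (Γ k y jj μ t) - 1‖ ≤ τ)
  (hγV : 0 < gammaV (Fintype.card o) P.d a' α τ)

/-- [folklore] `0 < ρ⋆` at the record. -/
theorem rhoStarOfRecord_pos : 0 < rhoStarOfRecord P Γ ι av hι hdist U ha' hα hτ hU hT hγV := rhoStar_pos P Γ _ _ _

/-- [folklore] **THE EXPLICIT BALL AT THE RECORD LIES IN THE LEVEL-LETTERED REGULAR SET** (printed letters, chart centred at `towerDataOf P ι av U`). -/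
theorem ball_rhoStarOfRecord_subset_regularSetLev :
    Metric.ball (0 : TowerData P o) (rhoStarOfRecord P Γ ι av hι hdist U ha' hα hτ hU hT hγV)
      ⊆ regularSetLev P (cPr P) (aPr P a') Γ (towerDataOf P ι av U) :=
  ball_rhoStar_subset_regularSetLev P Γ _ _ _

/-- [folklore] `‖greenT_k‖ ≤ 2/gammaV` at EVERY level on the explicit ball at the record. -/
theorem opNorm_greenT_le_on_ball_towerDataOf {A : TowerData P o}
    (hA : A ∈ Metric.ball (0 : TowerData P o) (rhoStarOfRecord P Γ ι av hι hdist U ha' hα hτ hU hT hγV)) (k : Fin (P.K + 1)) :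
    ‖greenT (lev P.L k) (unitMod P) (cPr P k) (aPr P a' k) (Γ k) (expChartT P (towerDataOf P ι av U) A k)
        (expChartInvT P (towerDataOf P ι av U) A k)‖ ≤ 2 / gammaV (Fintype.card o) P.d a' α τ :=
  opNorm_greenT_le_on_ball P Γ _ _ _ hA k

include hι hdist ha' hα hτ hU hT hγV in
/-- [folklore] The centre of the chart at the record is regular at every level at the printed letters. -/
theorem zero_mem_regularSetLev_printed_towerDataOf : (0 : TowerData P o) ∈ regularSetLev P (cPr P) (aPr P a') Γ (towerDataOf P ι av U) :=
  ball_rhoStarOfRecord_subset_regularSetLev P Γ ι av hι hdist U ha' hα hτ hU hT hγV (Metric.mem_ball_self (rhoStarOfRecord_pos ..))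

/-- [folklore] **THE QUANTITATIVE ANALYTIC BALL AT THE RECORD**: at the printed letters every entry of `covAtTLev` along the chart centred at the
tower data of record is analytic on `ball 0 ρ⋆` at every level — hypotheses: unitary `ι` with `‖ι g − 1‖ = dist1 g`, the small-field letters
`α`, `τ` at every level, `0 < a′`, `0 < gammaV`; nothing else displayed. -/
theorem analyticOnNhd_covAtTLev_printed_towerDataOf (k : ℕ) {T : Type*} (t : T) (b b' : (Tor (unitMod P) × Fin P.d) × o) :
    AnalyticOnNhd ℂ (fun A : TowerData P o => covAtTLev P (cPr P) (aPr P a') Γ s (expChartT P (towerDataOf P ι av U) A)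
        (expChartInvT P (towerDataOf P ι av U) A) k t b b')
      (Metric.ball (0 : TowerData P o) (rhoStarOfRecord P Γ ι av hι hdist U ha' hα hτ hU hT hγV)) :=
  analyticOnNhd_covAtTLev_printed_on_ball P Γ _ _ _ s k t b b'

include hι hdist ha' hα hτ hU hT hγV in
/-- [folklore] … in the `∃ ρ > 0` shape (witness `rhoStarOfRecord`). -/
theorem exists_ball_analyticOnNhd_covAtTLev_printed_towerDataOf :
    ∃ ρ > 0, ∀ (k : ℕ) {T : Type*} (t : T) (b b' : (Tor (unitMod P) × Fin P.d) × o),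
      AnalyticOnNhd ℂ (fun A : TowerData P o => covAtTLev P (cPr P) (aPr P a') Γ s (expChartT P (towerDataOf P ι av U) A)
          (expChartInvT P (towerDataOf P ι av U) A) k t b b')
        (Metric.ball (0 : TowerData P o) ρ) :=
  ⟨_, rhoStarOfRecord_pos P Γ ι av hι hdist U ha' hα hτ hU hT hγV,
    fun k _ t b b' => analyticOnNhd_covAtTLev_printed_towerDataOf P Γ s ι av hι hdist U ha' hα hτ hU hT hγV k t b b'⟩

end Record

end Summit.QuantumFields.BalabanUV.T4Continuum.SubstrateTransporterSpeciesLev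

end
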